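import Summits.Ventures.PercRepro.TriangleCapEightG

/-!
# PercRepro — the triangle cap at nullity `8`: `P(8) = 13`, PART H — the theorem (p3, gen 22)

**`ncard_triangles_le_thirteen_of_nullity_eight`**: under (C1), (C2), (C3) a finite matroid of nullity `8` has
at most `13` triangles — the census value `P(8) = 13` of P3-TRIANGLE-CAP.md §4 (two seats on the search),
one below p2's `S1.ncard_triangles_le_fourteen_of_nullity_eight`. Coloops are stripped as in p2's chain; on a
coloop-free matroid with `14` triangles part A gives every degree `≥ 3`, `13 ≤ |E| ≤ 14`, rank `≥ 5` and a point
`x` of degree `3`; its cone (p2's `S1.cone_ncard_eRk`, `S1.no_triangle_in_cone_avoiding_apex`) feeds part G's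
`false_of_fourteen`. The core form `core_ncard_triangles_le_thirteen_of_nullity_eight` takes the `e`-free
hypothesis of S1's modules.

Axioms: standard.
-/

open scoped Matroid

namespace PercRepro

namespace TriangleCap

open Set

variable {α : Type}

/-- **The coloop-free case**: at most `13` triangles. -/
theorem ncard_triangles_le_thirteen_of_coloopFree (M : Matroid α) [M.Finite]
    (hC1 : ∀ L ⊆ M.E, M.eRk L = 2 → L.ncard ≤ 3) (hC2 : ∀ P ⊆ M.E, M.eRk P ≤ 3 → P.ncard ≤ 6)
    (hC3 : ∀ X ⊆ M.E, M.eRk X ≤ 4 → X.ncard ≤ 10) (hd : M.E.encard = M.eRank + ((8 : ℕ) : ℕ∞))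
    (hcol : ∀ x ∈ M.E, ¬ M.IsColoop x) : (ThmN.triangles M).ncard ≤ 13 := by
  by_contra hgt
  have h14le := S1.ncard_triangles_le_fourteen_of_nullity_eight M hC1 hC2 hC3 hd
  have hs14 : (ThmN.triangles M).ncard = 14 := by omega
  have hs14' : 14 ≤ (ThmN.triangles M).ncard := by omega
  have hdeg : ∀ y ∈ M.E, 3 ≤ (ThmN.trianglesThrough M y).ncard :=
    fun y hy => three_le_degree_of_fourteen M hC1 hC2 hC3 hd hcol hs14' hy
  have hm14 := ncard_ground_le_fourteen M hdeg hs14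
  obtain ⟨r, hr, hnr, hr5⟩ := exists_rank_of_fourteen M hC1 hC2 hC3 hd hs14'
  have hm13 : 13 ≤ M.E.ncard := by omega
  obtain ⟨x, hxE, hx3⟩ := exists_degree_three_of_fourteen M hdeg hs14 hm13
  -- the three lines through `x` and the cone
  obtain ⟨L₁, L₂, L₃, h12, h13, h23, hLset⟩ := Set.ncard_eq_three.1 hx3
  have h1 : L₁ ∈ ThmN.trianglesThrough M x := by rw [hLset]; simp
  have h2 : L₂ ∈ ThmN.trianglesThrough M x := by rw [hLset]; simp
  have h3 : L₃ ∈ ThmN.trianglesThrough M x := by rw [hLset]; simp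
  have hxnl : M.IsNonloop x := isNonloop_of_mem_triangle M ⟨h1.1, h1.2.1⟩ h1.2.2
  have hthree' : ∀ L ∈ ThmN.trianglesThrough M x, L = L₁ ∨ L = L₂ ∨ L = L₃ := by
    intro L hL
    rw [hLset] at hL
    simpa using hL
  obtain ⟨hn7, hr4⟩ := S1.cone_ncard_eRk M hC1 hC2 hxnl h1 h2 h3 h12 h13 h23
  have hXE : L₁ ∪ L₂ ∪ L₃ ⊆ M.E :=
    Set.union_subset (Set.union_subset h1.1.subset_ground h2.1.subset_ground) h3.1.subset_ground
  have hxX : x ∈ L₁ ∪ L₂ ∪ L₃ := Or.inl (Or.inl h1.2.2)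
  have hxT : ∀ T ∈ ThmN.trianglesThrough M x, T ⊆ L₁ ∪ L₂ ∪ L₃ := by
    intro T hT
    rcases hthree' T hT with rfl | rfl | rfl
    · exact fun z hz => Or.inl (Or.inl hz)
    · exact fun z hz => Or.inl (Or.inr hz)
    · exact fun z hz => Or.inr hz
  have hcone : ∀ T ∈ ThmN.triangles M, T ⊆ L₁ ∪ L₂ ∪ L₃ → x ∈ T := by
    intro T hT hTC
    by_contra hxT'
    exact S1.no_triangle_in_cone_avoiding_apex M hC1 hC2 hxnl hx3 h1 h2 h3 h12 h13 h23 hT hTC hxT'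
  exact false_of_fourteen M hC1 hC2 hC3 hs14 hdeg hr hnr hr5 hm14 hXE hn7 hr4 hxX hx3 hxT hcone

/-- **Nullity `8`: at most thirteen triangles** under (C1), (C2), (C3) — the census value `P(8) = 13`. -/
theorem ncard_triangles_le_thirteen_of_nullity_eight (M : Matroid α) [M.Finite]
    (hC1 : ∀ L ⊆ M.E, M.eRk L = 2 → L.ncard ≤ 3) (hC2 : ∀ P ⊆ M.E, M.eRk P ≤ 3 → P.ncard ≤ 6)
    (hC3 : ∀ X ⊆ M.E, M.eRk X ≤ 4 → X.ncard ≤ 10) (hd : M.E.encard = M.eRank + ((8 : ℕ) : ℕ∞)) :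
    (ThmN.triangles M).ncard ≤ 13 := by
  suffices H : ∀ n : ℕ, ∀ (M : Matroid α) [M.Finite], M.E.ncard = n →
      (∀ L ⊆ M.E, M.eRk L = 2 → L.ncard ≤ 3) → (∀ P ⊆ M.E, M.eRk P ≤ 3 → P.ncard ≤ 6) →
      (∀ X ⊆ M.E, M.eRk X ≤ 4 → X.ncard ≤ 10) →
      M.E.encard = M.eRank + ((8 : ℕ) : ℕ∞) → (ThmN.triangles M).ncard ≤ 13 from
    H _ M rfl hC1 hC2 hC3 hd
  intro n
  induction n using Nat.strong_induction_on with
  | _ n ih =>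
  intro M _ hn hC1 hC2 hC3 hd
  classical
  by_cases hcol : ∃ k ∈ M.E, M.IsColoop k
  · obtain ⟨k, hkE, hk⟩ := hcol
    have hlt : (M ＼ {k}).E.ncard < n := by
      rw [_root_.Matroid.delete_ground, ← hn]
      exact Set.ncard_sdiff_singleton_lt_of_mem hkE M.ground_finite
    have hC1' : ∀ L ⊆ (M ＼ {k}).E, (M ＼ {k}).eRk L = 2 → L.ncard ≤ 3 := by
      intro L hL hr
      rw [_root_.Matroid.delete_ground] at hL
      rw [delete_singleton_eRk_eq hL] at hr
      exact hC1 L (hL.trans Set.sdiff_subset) hr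
    have hC2' : ∀ P ⊆ (M ＼ {k}).E, (M ＼ {k}).eRk P ≤ 3 → P.ncard ≤ 6 := by
      intro P hP hr
      rw [_root_.Matroid.delete_ground] at hP
      rw [delete_singleton_eRk_eq hP] at hr
      exact hC2 P (hP.trans Set.sdiff_subset) hr
    have hd' : (M ＼ {k}).E.encard = (M ＼ {k}).eRank + ((8 : ℕ) : ℕ∞) :=
      S1.encard_delete_eq_of_isColoop M hk hd
    have := ih _ hlt (M ＼ {k}) rfl hC1' hC2' (hC3_delete M hC3 k) hd'
    rwa [S1.triangles_delete_eq_of_isColoop M hk] at this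
  have hcol' : ∀ x ∈ M.E, ¬ M.IsColoop x := fun x hx h => hcol ⟨x, hx, h⟩
  exact ncard_triangles_le_thirteen_of_coloopFree M hC1 hC2 hC3 hd hcol'

/-- **The census cap `P(8) = 13` on the `e`-free core.** -/
theorem core_ncard_triangles_le_thirteen_of_nullity_eight (M : Matroid α) [M.Finite]
    (hfree : ∀ e ∈ M.E, ∃ A ⊆ M.E \ {e}, e ∉ M.closure A ∧ e ∉ M.closure ((M.E \ {e}) \ A))
    (hd : M.E.encard = M.eRank + ((8 : ℕ) : ℕ∞)) :
    {C : Set α | M.IsCircuit C ∧ C.ncard = 3}.ncard ≤ 13 := by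
  have hL : ∀ e ∈ M.E, ¬ M.IsLoop e := ThmN.not_isLoop_of_free M hfree
  have hline : ∀ L ⊆ M.E, M.eRk L = 2 → L.ncard ≤ 3 := by
    intro L hL' hr
    have := ThmN.ncard_add_one_le_two_pow_of_eRk_le M hL hfree 2 L hL' hr.le
    omega
  have hplane : ∀ P ⊆ M.E, M.eRk P ≤ 3 → P.ncard ≤ 6 := fun P hP hr =>
    ThmN.ncard_le_six_of_eRk_le_three_of_free M hfree hP hr
  have hsolid : ∀ X ⊆ M.E, M.eRk X ≤ 4 → X.ncard ≤ 10 := fun X hX hr =>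
    ThmN.ncard_le_ten_of_eRk_le_four_of_free M hfree hX hr
  exact ncard_triangles_le_thirteen_of_nullity_eight M hline hplane hsolid hd

end TriangleCap

end PercRepro
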